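import Literature.NumberTheory.Sieve.HeathBrownCubicTypeIIClassISum
import Literature.NumberTheory.Sieve.HeathBrownCubicTypeIIUstarBound
import Literature.NumberTheory.Sieve.HeathBrownCubicTypeIIClassII
import Literature.NumberTheory.Sieve.HeathBrownCubicLemma45Pow
import HarnessLib

/-!
# Heath-Brown's Lemma 3.10, §§12–13: the bound for `S₄⁺`

Support for the proof of **Lemma 3.10** of D. R. Heath-Brown, *Primes represented by `x³ + 2y³`*,
Acta Math. 186 (2001), §§12–13 (Lemma 12.2 and its completion in §13):

> "LEMMA 12.2. There is an absolute constant `c > 0` such that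
> `S_V ≪ X²Y^{−1/2}(log X)^c + X^{3/2}V^{−1/2}Y^{75/2}S₈^{1/2}(log X)^c`, where `S₈` is given by (12.10)."
> (p. 77) "… `S₈ ≪ XV(YQ₀⁴ exp{−c√(log L)} + YQ₀^{1/2} … + YQ₀^{−1/2} + Y⁴⁶X^{−τ/2})(log X)^c`." (p. 83)

We decompose `S₄⁺ = ∑_{cells} S₅` by classes (`HeathBrownCubicTypeIILocalise`) and PROVE a closed-form
bound for `|S₄⁺|` in terms of the parameters `X, V, T, N, Δ₀, d₀, Q₀, Q₁` and the hypothesis (3.14)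
(`exists_S4plus_bound`): Class 0 cells vanish, Class II cells are bounded by Lemma 11.1 and their number
by `card_classII_le`, Class I cells by `sum_abs_classISum_le` (Möbius, characters, weights, tail) and
`sum_wt_Ustar_le` (large sieve and (3.14)), with the per-hypercube divisor sums bounded by Lemma 4.5.

## References

* D. R. Heath-Brown, *Primes represented by `x³ + 2y³`*, Acta Math. 186 (2001), §§12–13, Lemma 12.2.
  [cite: HeathBrownActa2001, Lemma 12.2]

## Mathlib / tree search

Tree: `HeathBrownCubicTypeIILocalise` (`S4plus_eq_sum_S5`, `S5_eq_zero_of_class0`, `S5_eq_S6_of_classI`,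
`abs_S5_le_S7`, `sum_Dset_inv_sq_le`, `card_Trange_le`, `card_Nrange_le`), `HeathBrownCubicTypeIIClassII`
(`card_classII_le`), `HeathBrownCubicLemma111` (`HeathBrown2001_lemma_11_1`), `HeathBrownCubicTypeIIClassISum`
(`sum_abs_classISum_le`), `HeathBrownCubicTypeIIUstarBound` (`sum_wt_Ustar_le`), `HeathBrownCubicLemma45Pow`.
-/

noncomputable section

open Finset NumberField

namespace Literature.NumberTheory.Sieve.CubicSieve

open LFunctions.CubeRootTwoField CubicPrimes LargeSieve

variable {X η τ V T : ℝ} {k : ℕ} {m : Fin k → ℕ} {N : ℕ} {Δ₀ : ℝ}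

/-! ### `S₄⁺` by classes -/

open scoped Classical in
/-- **`S₄⁺ = ∑_{(𝐧,𝐧')} ∑_{t Class I} S₆ + ∑_{Class II cells} S₅`** (Class 0 cells vanish).
[cite: HeathBrownActa2001, Lemma 12.1] -/
theorem S4plus_eq_classI_add_classII (hX : 0 < X) (hη1 : η ≤ 1) (hT : 0 < T) (hTV : T ^ 3 = V) (hN : 0 < N)
    (hΔ : 1 ≤ Δ₀) :
    S4plus X η τ m V T Δ₀ =
      ∑ nn ∈ Nrange N ×ˢ Nrange N, classISum X η τ m V T N Δ₀ nn.1 nn.2 +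
      ∑ c ∈ (Trange N Δ₀ (270 * V / X) ×ˢ (Nrange N ×ˢ Nrange N)).filter
          (fun c => ¬ ClassI X η T V N c.1 c.2.1 c.2.2 ∧ ¬ Class0 X η T V N c.1 c.2.1 c.2.2),
        S5 X η τ m V T N Δ₀ c := by
  classical
  rw [S4plus_eq_sum_S5 hX hT hTV hN hΔ]
  set TR := Trange N Δ₀ (270 * V / X) with hTR
  set NN := Nrange N ×ˢ Nrange N with hNN
  rw [← sum_filter_add_sum_filter_not (TR ×ˢ NN) (fun c => ClassI X η T V N c.1 c.2.1 c.2.2)]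
  congr 1
  · -- Class I cells
    calc ∑ c ∈ (TR ×ˢ NN).filter (fun c => ClassI X η T V N c.1 c.2.1 c.2.2), S5 X η τ m V T N Δ₀ c
        = ∑ c ∈ (TR ×ˢ NN).filter (fun c => ClassI X η T V N c.1 c.2.1 c.2.2), S6 X τ m T N Δ₀ c.1 c.2.1 c.2.2 := by
          refine sum_congr rfl fun c hc => ?_
          rw [mem_filter] at hc
          have := S5_eq_S6_of_classI (τ := τ) (m := m) (Δ₀ := Δ₀) hX hT hTV hN hc.2
          rw [← this]
      _ = ∑ c ∈ TR ×ˢ NN, (if ClassI X η T V N c.1 c.2.1 c.2.2 then S6 X τ m T N Δ₀ c.1 c.2.1 c.2.2 else 0) := by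
          rw [sum_filter]
      _ = ∑ nn ∈ NN, ∑ t ∈ TR, (if ClassI X η T V N t nn.1 nn.2 then S6 X τ m T N Δ₀ t nn.1 nn.2 else 0) := by
          rw [sum_product_right]
      _ = ∑ nn ∈ NN, classISum X η τ m V T N Δ₀ nn.1 nn.2 := by
          refine sum_congr rfl fun nn _ => ?_
          rw [classISum, TI, sum_filter]
  · -- the rest: Class 0 cells vanish
    rw [← sum_filter_add_sum_filter_not ((TR ×ˢ NN).filter (fun c => ¬ClassI X η T V N c.1 c.2.1 c.2.2))
      (fun c => Class0 X η T V N c.1 c.2.1 c.2.2)]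
    have h0 : ∑ c ∈ ((TR ×ˢ NN).filter (fun c => ¬ClassI X η T V N c.1 c.2.1 c.2.2)).filter
        (fun c => Class0 X η T V N c.1 c.2.1 c.2.2), S5 X η τ m V T N Δ₀ c = 0 := by
      refine sum_eq_zero fun c hc => ?_
      rw [mem_filter] at hc
      have := S5_eq_zero_of_class0 (τ := τ) (m := m) (Δ₀ := Δ₀) hX hη1 hT hTV hN hc.2
      rw [← this]
    rw [h0, zero_add, filter_filter]

/-! ### The Class II cells -/

/-- Coordinates of the lower corner of a hypercube of `Nrange`: `|s(n_i − 1)| ≤ s(3N + 2)`. [folklore] -/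
theorem abs_corner_le {s : ℝ} (hs : 0 ≤ s) {N : ℕ} {n : ℤ × ℤ × ℤ} (hn : n ∈ Nrange N) :
    |(corner s n).1| ≤ s * (3 * N + 2) ∧ |(corner s n).2.1| ≤ s * (3 * N + 2) ∧ |(corner s n).2.2| ≤ s * (3 * N + 2) := by
  obtain ⟨h1, h2, h3⟩ := abs_le_of_mem_cube hn
  simp only [corner, abs_mul, abs_of_nonneg hs]
  refine ⟨?_, ?_, ?_⟩
  · refine mul_le_mul_of_nonneg_left ?_ hs
    calc |(n.1 : ℝ) - 1| ≤ |(n.1 : ℝ)| + |(1 : ℝ)| := abs_sub _ _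
      _ ≤ 3 * N + 2 := by rw [abs_one]; linarith
  · refine mul_le_mul_of_nonneg_left ?_ hs
    calc |(n.2.1 : ℝ) - 1| ≤ |(n.2.1 : ℝ)| + |(1 : ℝ)| := abs_sub _ _
      _ ≤ 3 * N + 2 := by rw [abs_one]; linarith
  · refine mul_le_mul_of_nonneg_left ?_ hs
    calc |(n.2.2 : ℝ) - 1| ≤ |(n.2.2 : ℝ)| + |(1 : ℝ)| := abs_sub _ _
      _ ≤ 3 * N + 2 := by rw [abs_one]; linarith

open scoped Classical in
/-- **Lemma 11.1 on a cell**: with the constant `C₁₁` of Lemma 11.1 (`A = 3`, `κ`), for hypercubes of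
`Nrange` with `s = T/N ≥ 2`, `3N + 2 ≤ s²` and `270V/X ≤ κs`:
`S₇(t, 𝐧, 𝐧') ≤ C₁₁ s⁶ (log s)^{E} (2/(NΔ₀) + 3/Δ₀²)`. [cite: HeathBrownActa2001, Lemma 12.1] -/
theorem S7_le {C₁₁ κ : ℝ} {E : ℕ} (hC₁₁ : 0 < C₁₁)
    (h11 : ∀ (a₁ a₂ : ℝ × ℝ × ℝ) (S₀ : ℝ), 2 ≤ S₀ →
      |a₁.1| ≤ S₀ ^ 3 → |a₁.2.1| ≤ S₀ ^ 3 → |a₁.2.2| ≤ S₀ ^ 3 →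
        ∀ D : ℕ, 1 ≤ D → (D : ℝ) ≤ κ * S₀ →
          ∑ b ∈ (latticeCube a₁ S₀).filter IsPrimitiveVec,
              ∑ _x ∈ (latticeCube a₂ S₀).filter (fun x => DvdVec (D : ℤ) (cross3 b x)),
                (idealDivisorCount (Ideal.span {coordElt b}) : ℝ) ^ 2 ≤
            C₁₁ * S₀ ^ 6 / (D : ℝ) ^ 2 * Real.log S₀ ^ E)
    (hN : 0 < N) (hs2 : 2 ≤ T / N) (hsN : 3 * (N : ℝ) + 2 ≤ (T / N) ^ 2)
    (hκs : 270 * V / X ≤ κ * (T / N)) (hΔ : 0 < Δ₀) (t : ℕ) {n : ℤ × ℤ × ℤ} (hn : n ∈ Nrange N) (n' : ℤ × ℤ × ℤ) :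
    ∑ D ∈ Dset X V N Δ₀ t, ∑ b₁ ∈ (LC (T / N) n).filter IsPrimitiveVec,
        ∑ _b₂ ∈ (LC (T / N) n').filter (fun b₂ => DvdVec (D : ℤ) (cross3 b₁ b₂)),
          (idealDivisorCount (Ideal.span {coordElt b₁}) : ℝ) ^ 2 ≤
      C₁₁ * (T / N) ^ 6 * Real.log (T / N) ^ E * (2 / (N * Δ₀) + 3 / Δ₀ ^ 2) := by
  classical
  set s : ℝ := T / N with hs
  have hs0 : 0 ≤ s := by linarith
  have hlog : 0 ≤ Real.log s := Real.log_nonneg (by linarith)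
  have hcorner : ∀ n₀ ∈ Nrange N, |(corner s n₀).1| ≤ s ^ 3 ∧ |(corner s n₀).2.1| ≤ s ^ 3 ∧ |(corner s n₀).2.2| ≤ s ^ 3 := by
    intro n₀ hn₀
    obtain ⟨a1, a2, a3⟩ := abs_corner_le hs0 hn₀
    have : s * (3 * N + 2) ≤ s ^ 3 := by
      calc s * (3 * N + 2) ≤ s * s ^ 2 := mul_le_mul_of_nonneg_left hsN hs0
        _ = s ^ 3 := by ring
    exact ⟨a1.trans this, a2.trans this, a3.trans this⟩
  obtain ⟨c1, c2, c3⟩ := hcorner n hn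
  have hterm : ∀ D ∈ Dset X V N Δ₀ t,
      ∑ b₁ ∈ (LC s n).filter IsPrimitiveVec, ∑ _b₂ ∈ (LC s n').filter (fun b₂ => DvdVec (D : ℤ) (cross3 b₁ b₂)),
          (idealDivisorCount (Ideal.span {coordElt b₁}) : ℝ) ^ 2 ≤ C₁₁ * s ^ 6 * Real.log s ^ E * ((D : ℝ) ^ 2)⁻¹ := by
    intro D hD
    rw [Dset, mem_filter, mem_Icc] at hD
    obtain ⟨⟨hD1, hDmax⟩, -, -⟩ := hD
    have hDκ : (D : ℝ) ≤ κ * s := by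
      have h1 : (D : ℝ) ≤ ⌊270 * V / X⌋₊ := by exact_mod_cast hDmax
      have h2 : (⌊270 * V / X⌋₊ : ℝ) ≤ 270 * V / X := Nat.floor_le (by
        have : (0:ℝ) ≤ D := Nat.cast_nonneg D
        by_contra hneg; push Not at hneg
        have : ⌊270 * V / X⌋₊ = 0 := Nat.floor_eq_zero.mpr (by linarith)
        rw [this] at hDmax; omega)
      linarith
    have h := h11 (corner s n) (corner s n') s hs2 c1 c2 c3 D hD1 hDκ
    rw [LC, LC]
    refine h.trans (le_of_eq ?_)
    field_simp
  calc ∑ D ∈ Dset X V N Δ₀ t, ∑ b₁ ∈ (LC s n).filter IsPrimitiveVec,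
        ∑ _b₂ ∈ (LC s n').filter (fun b₂ => DvdVec (D : ℤ) (cross3 b₁ b₂)), (idealDivisorCount (Ideal.span {coordElt b₁}) : ℝ) ^ 2
      ≤ ∑ D ∈ Dset X V N Δ₀ t, C₁₁ * s ^ 6 * Real.log s ^ E * ((D : ℝ) ^ 2)⁻¹ := sum_le_sum hterm
    _ = C₁₁ * s ^ 6 * Real.log s ^ E * ∑ D ∈ Dset X V N Δ₀ t, ((D : ℝ) ^ 2)⁻¹ := by rw [mul_sum]
    _ ≤ C₁₁ * s ^ 6 * Real.log s ^ E * (2 / (N * Δ₀) + 3 / Δ₀ ^ 2) := by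
        refine mul_le_mul_of_nonneg_left (sum_Dset_inv_sq_le hN hΔ t) ?_
        exact mul_nonneg (by positivity) (pow_nonneg hlog _)

open scoped Classical in
/-- **The Class II cells**: `∑_{Class II cells} |S₅| ≤ #Trange · 3.4·10¹⁰(6N+3)⁵ · 81 · C₁₁s⁶(log s)^E (2/(NΔ₀) + 3/Δ₀²)`.
[cite: HeathBrownActa2001, §12 p. 75] -/
theorem sum_classII_abs_S5_le (hX : 1 < X) (hη0 : 0 ≤ η) (hη1 : η ≤ 1) (hτ : 0 < τ) (hτ1 : τ ≤ 1) {nn : ℕ}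
    {m : Fin (nn + 1) → ℕ} (hm : CoreAdmissible τ m) (hT : 0 < T) (hTV : T ^ 3 = V) (hN : 1248 ≤ N)
    {C₁₁ κ : ℝ} {E : ℕ} (hC₁₁ : 0 < C₁₁)
    (h11 : ∀ (a₁ a₂ : ℝ × ℝ × ℝ) (S₀ : ℝ), 2 ≤ S₀ →
      |a₁.1| ≤ S₀ ^ 3 → |a₁.2.1| ≤ S₀ ^ 3 → |a₁.2.2| ≤ S₀ ^ 3 →
        ∀ D : ℕ, 1 ≤ D → (D : ℝ) ≤ κ * S₀ →
          ∑ b ∈ (latticeCube a₁ S₀).filter IsPrimitiveVec,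
              ∑ _x ∈ (latticeCube a₂ S₀).filter (fun x => DvdVec (D : ℤ) (cross3 b x)),
                (idealDivisorCount (Ideal.span {coordElt b}) : ℝ) ^ 2 ≤
            C₁₁ * S₀ ^ 6 / (D : ℝ) ^ 2 * Real.log S₀ ^ E)
    (hs2 : 2 ≤ T / N) (hsN : 3 * (N : ℝ) + 2 ≤ (T / N) ^ 2) (hκs : 270 * V / X ≤ κ * (T / N))
    (hΔ1 : 1 ≤ Δ₀) (hΔD : Δ₀ ≤ 270 * V / X) :
    ∑ c ∈ (Trange N Δ₀ (270 * V / X) ×ˢ (Nrange N ×ˢ Nrange N)).filter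
        (fun c => ¬ ClassI X η T V N c.1 c.2.1 c.2.2 ∧ ¬ Class0 X η T V N c.1 c.2.1 c.2.2),
        |S5 X η τ m V T N Δ₀ c| ≤
      ((N : ℝ) * (Real.log (270 * V / X) - Real.log Δ₀) + 2) * (34000000000 * (6 * (N : ℝ) + 3) ^ 5) *
        (81 * (C₁₁ * (T / N) ^ 6 * Real.log (T / N) ^ E * (2 / (N * Δ₀) + 3 / Δ₀ ^ 2))) := by
  classical
  have hX0 : 0 < X := by linarith
  have hN0 : 0 < N := by omega
  have hΔ0 : 0 < Δ₀ := by linarith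
  set TR := Trange N Δ₀ (270 * V / X) with hTR
  set NN := Nrange N ×ˢ Nrange N with hNN
  set B7 : ℝ := C₁₁ * (T / N) ^ 6 * Real.log (T / N) ^ E * (2 / (N * Δ₀) + 3 / Δ₀ ^ 2) with hB7
  have hlog : 0 ≤ Real.log (T / N) := Real.log_nonneg (by linarith)
  have hB70 : 0 ≤ B7 := by
    rw [hB7]; exact mul_nonneg (mul_nonneg (by positivity) (pow_nonneg hlog _)) (by positivity)
  -- per cell
  have hcell : ∀ c ∈ (TR ×ˢ NN).filter (fun c => ¬ ClassI X η T V N c.1 c.2.1 c.2.2 ∧ ¬ Class0 X η T V N c.1 c.2.1 c.2.2),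
      |S5 X η τ m V T N Δ₀ c| ≤ 81 * B7 := by
    intro c hc
    rw [mem_filter, mem_product, hNN, mem_product] at hc
    obtain ⟨⟨-, hn, hn'⟩, -⟩ := hc
    have h := abs_S5_le_S7 hX hη1 hτ hτ1 hm hT hTV hN0 (Δ₀ := Δ₀) c.1 c.2.1 c.2.2
    have h7 := S7_le hC₁₁ h11 hN0 hs2 hsN hκs hΔ0 c.1 hn c.2.2
    have h7' := S7_le hC₁₁ h11 hN0 hs2 hsN hκs hΔ0 c.1 hn' c.2.1
    rw [← hB7] at h7 h7'
    have : (c.1, c.2.1, c.2.2) = c := rfl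
    rw [this] at h
    linarith
  -- count
  calc ∑ c ∈ (TR ×ˢ NN).filter (fun c => ¬ ClassI X η T V N c.1 c.2.1 c.2.2 ∧ ¬ Class0 X η T V N c.1 c.2.1 c.2.2),
        |S5 X η τ m V T N Δ₀ c|
      ≤ ∑ _c ∈ (TR ×ˢ NN).filter (fun c => ¬ ClassI X η T V N c.1 c.2.1 c.2.2 ∧ ¬ Class0 X η T V N c.1 c.2.1 c.2.2),
          81 * B7 := sum_le_sum hcell
    _ = #((TR ×ˢ NN).filter (fun c => ¬ ClassI X η T V N c.1 c.2.1 c.2.2 ∧ ¬ Class0 X η T V N c.1 c.2.1 c.2.2)) * (81 * B7) := by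
        rw [sum_const, nsmul_eq_mul]
    _ ≤ (((N : ℝ) * (Real.log (270 * V / X) - Real.log Δ₀) + 2) * (34000000000 * (6 * (N : ℝ) + 3) ^ 5)) * (81 * B7) := by
        refine mul_le_mul_of_nonneg_right ?_ (by positivity)
        rw [card_filter_prod_eq_sum, Nat.cast_sum]
        calc ∑ t ∈ TR, (#(NN.filter (fun nn => ¬ ClassI X η T V N (t, nn).1 (t, nn).2.1 (t, nn).2.2 ∧
              ¬ Class0 X η T V N (t, nn).1 (t, nn).2.1 (t, nn).2.2)) : ℝ)
            ≤ ∑ _t ∈ TR, (34000000000 * (6 * (N : ℝ) + 3) ^ 5) := by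
              refine sum_le_sum fun t _ => ?_
              have := card_classII_le hX0 hη0 hη1 hT hTV hN t
              rw [hNN]; exact this
          _ = #TR * (34000000000 * (6 * (N : ℝ) + 3) ^ 5) := by rw [sum_const, nsmul_eq_mul]
          _ ≤ _ := by
              gcongr
              exact card_Trange_le hΔ1 hΔD
    _ = _ := by ring

/-! ### The hypercubes of a Class I cell satisfy the conditions of (3.14) -/

/-- `realCube (corner s 𝐧) s ⊆ realCell s 𝐧`. [folklore] -/
theorem realCube_corner_subset_realCell (s : ℝ) (n : ℤ × ℤ × ℤ) : realCube (corner s n) s ⊆ realCell s n := by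
  intro p hp
  simp only [realCube, corner, Set.mem_prod, Set.mem_Ioc] at hp
  obtain ⟨⟨h1, h1'⟩, ⟨h2, h2'⟩, ⟨h3, h3'⟩⟩ := hp
  refine ⟨⟨h1.le, by linarith⟩, ⟨h2.le, by linarith⟩, ⟨h3.le, by linarith⟩⟩

/-- `V^{1/3} = T` for `T³ = V`, `T ≥ 0`. [folklore] -/
theorem rpow_third_eq (hT : 0 ≤ T) (hTV : T ^ 3 = V) : V ^ (1 / 3 : ℝ) = T := by
  rw [← hTV, ← Real.rpow_natCast, ← Real.rpow_mul hT]; norm_num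

/-- **A good hypercube satisfies the cube conditions of (3.14) with `c₃ = 3`, `c₄ = 1`**:
`|x|, |y|, |z| ≤ 3V^{1/3}` and `N(x,y,z) ≥ V` on it ((11.5) and `V < N(β)`). [cite: HeathBrownActa2001, §11 (11.5)] -/
theorem cubeCond_of_goodCube (hT : 0 < T) (hTV : T ^ 3 = V) {N : ℕ} {n : ℤ × ℤ × ℤ} (hg : goodCube V T N n) :
    CubeCond 3 1 V (corner (T / N) n) (T / N) := by
  intro p hp
  have hG := hg p (realCube_corner_subset_realCell _ _ hp)
  obtain ⟨⟨h1, h2⟩, ⟨hN1, hN2⟩⟩ := hG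
  obtain ⟨a1, a2, a3⟩ := abs_coord_le_of_inWindow hT hTV h1 h2 hN2
  rw [rpow_third_eq hT.le hTV, one_mul]
  refine ⟨a1, a2, a3, ?_⟩
  have : normForm p = p.1 ^ 3 + 2 * p.2.1 ^ 3 + 4 * p.2.2 ^ 3 - 6 * p.1 * p.2.1 * p.2.2 := rfl
  linarith

/-- The lattice points of a good hypercube are nonzero with `h.c.f. ≤ ⌊3T⌋₊ + 1`. [folklore] -/
theorem hcf3_le_of_goodCube (hT : 0 < T) (hTV : T ^ 3 = V) (hN : 0 < N) {n : ℤ × ℤ × ℤ} (hg : goodCube V T N n)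
    {v : ℤ × ℤ × ℤ} (hv : v ∈ LC (T / N) n) : v ≠ 0 ∧ hcf3 v ≤ ⌊3 * T⌋₊ + 1 := by
  obtain ⟨-, hB, -, -, -, hne⟩ := good_point_facts hT hTV hN hg hv
  refine ⟨hne, ?_⟩
  have h1 : (hcf3 v : ℝ) ≤ (supZ v : ℝ) := by exact_mod_cast hcf3_le_supZ hne
  have h2 : (supZ v : ℝ) ≤ 3 * T := supZ_le_of_mem_cube hB
  have h3 := Nat.lt_floor_add_one (3 * T)
  have : (hcf3 v : ℝ) < ((⌊3 * T⌋₊ + 1 : ℕ) : ℝ) := by push_cast; linarith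
  exact_mod_cast this.le

/-! ### The Class I part for good hypercubes -/

open scoped Classical in
/-- **`∑_{q ≤ d₀} w(q) U*(C(𝐧), q)` for a good hypercube `𝐧 ∈ Nrange`**, with the per-hypercube divisor sums
bounded by Lemma 4.5 (constants `C₂, e₂` for `τ²`, `C₃, e₃` for `τ³`; `A = 3`, so `|corner| ≤ s³` needs
`3N + 2 ≤ s²`). [cite: HeathBrownActa2001, §13 pp. 81–83] -/
theorem sum_wt_Ustar_good_le (hX : 1 < X) (hτ : 0 < τ) (hτ1 : τ ≤ 1) {nn : ℕ} {m : Fin (nn + 1) → ℕ}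
    (hm : CoreAdmissible τ m) {Q₁ C₁ c₁ : ℝ} (hHyp : Hyp314 X τ m Q₁ C₁ c₁ 3 1) (hT : 0 < T) (hTV : T ^ 3 = V)
    (hN : 0 < N) (hs2 : 2 ≤ T / N) (hsN : 3 * (N : ℝ) + 2 ≤ (T / N) ^ 2) (hsL : hbL X τ ^ 2 ≤ T / N)
    {C₂ C₃ : ℝ} {e₂ e₃ : ℕ} (hC₃ : 0 < C₃)
    (h45₂ : ∀ (a : ℝ × ℝ × ℝ) (S₀ : ℝ), 2 ≤ S₀ → |a.1| ≤ S₀ ^ 3 → |a.2.1| ≤ S₀ ^ 3 → |a.2.2| ≤ S₀ ^ 3 →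
      ∑ v ∈ latticeCube a S₀, (idealDivisorCount (Ideal.span {coordElt v}) : ℝ) ^ 2 ≤ C₂ * S₀ ^ 3 * Real.log S₀ ^ e₂)
    (h45₃ : ∀ (a : ℝ × ℝ × ℝ) (S₀ : ℝ), 2 ≤ S₀ → |a.1| ≤ S₀ ^ 3 → |a.2.1| ≤ S₀ ^ 3 → |a.2.2| ≤ S₀ ^ 3 →
      ∑ v ∈ latticeCube a S₀, (idealDivisorCount (Ideal.span {coordElt v}) : ℝ) ^ 3 ≤ C₃ * S₀ ^ 3 * Real.log S₀ ^ e₃)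
    {Q₀ : ℕ} (hQ₀ : 1 ≤ Q₀) (hQ₀₁ : (Q₀ : ℝ) ≤ Q₁) {Δ₀ : ℝ} (hΔ : 0 < Δ₀) {d₀ : ℝ} (hd₀ : 1 ≤ d₀) (Dmax : ℕ)
    {n : ℤ × ℤ × ℤ} (hn : n ∈ Nrange N) (hg : goodCube V T N n) :
    ∑ q ∈ Icc 1 ⌊d₀⌋₊, wt Δ₀ Dmax d₀ q * Ustar (Fprim X τ m) (LC (T / N) n) q ≤
      4 * (1 + Real.log Q₀) / Δ₀ * (Q₀ : ℝ) ^ 3 *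
          (2 * ((Q₀ : ℝ) ^ 4 * Q₁ ^ 2 * (C₁ * V * Real.exp (-(c₁ * Real.sqrt (Real.log (hbL X τ))))) ^ 2 +
            162 * (C₃ * (T / N) ^ 3 * Real.log (T / N) ^ e₃) ^ (2 / 3 : ℝ) *
              (2 * (T / N) ^ 2 / (Q₁ / Q₀) + 2 * (T / N) * (1 + Real.log ((⌊3 * T⌋₊ + 1 : ℕ) : ℝ)) + ((⌊3 * T⌋₊ + 1 : ℕ) : ℝ)) ^ 2)) +
        414720 * (1 + Real.log (2 * d₀)) / Δ₀ *
          ((T / N + 1) ^ 3 / Q₀ + d₀ * (T / N + 1) ^ 2 + d₀ ^ 3) * (81 * (C₂ * (T / N) ^ 3 * Real.log (T / N) ^ e₂)) := by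
  classical
  set s : ℝ := T / N with hs
  have hs0 : 0 ≤ s := by linarith
  have hlog : 0 ≤ Real.log s := Real.log_nonneg (by linarith)
  have hQR : (0 : ℝ) < Q₀ := by exact_mod_cast hQ₀
  have hG1 : 1 ≤ Q₁ / Q₀ := by rw [le_div_iff₀ hQR]; linarith
  -- hypotheses of `sum_wt_Ustar_le`
  have hcube := cubeCond_of_goodCube hT hTV hg
  have hC0 : ∀ v ∈ latticeCube (corner s n) s, v ≠ 0 := fun v hv => (hcf3_le_of_goodCube hT hTV hN hg hv).1
  have hM : ∀ v ∈ latticeCube (corner s n) s, hcf3 v ≤ ⌊3 * T⌋₊ + 1 := fun v hv => (hcf3_le_of_goodCube hT hTV hN hg hv).2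
  have h := sum_wt_Ustar_le hX hτ hτ1 hm hHyp (by rw [← hTV]; positivity) hs0 hsL hcube hC0 hM hQ₀ hQ₀₁ hΔ hd₀ Dmax
  rw [LC]
  refine h.trans ?_
  -- the per-hypercube divisor sums
  obtain ⟨c1, c2, c3⟩ := abs_corner_le hs0 hn
  have hc3 : s * (3 * N + 2) ≤ s ^ 3 := by
    calc s * (3 * N + 2) ≤ s * s ^ 2 := mul_le_mul_of_nonneg_left hsN hs0
      _ = s ^ 3 := by ring
  have hS3 : ∑ v ∈ latticeCube (corner s n) s, (idealDivisorCount (Ideal.span {coordElt v}) : ℝ) ^ 3 ≤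
      C₃ * s ^ 3 * Real.log s ^ e₃ := h45₃ _ _ hs2 (c1.trans hc3) (c2.trans hc3) (c3.trans hc3)
  have hF2 : ∑ v ∈ latticeCube (corner s n) s, Fprim X τ m v ^ 2 ≤ 81 * (C₂ * s ^ 3 * Real.log s ^ e₂) := by
    calc ∑ v ∈ latticeCube (corner s n) s, Fprim X τ m v ^ 2
        ≤ ∑ v ∈ latticeCube (corner s n) s, 81 * (idealDivisorCount (Ideal.span {coordElt v}) : ℝ) ^ 2 := by
          refine sum_le_sum fun v _ => ?_
          have h1 := abs_Fprim_le hX hτ hτ1 hm v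
          rw [tauK] at h1
          have h0 : 0 ≤ (idealDivisorCount (Ideal.span {coordElt v}) : ℝ) := Nat.cast_nonneg _
          nlinarith [abs_nonneg (Fprim X τ m v), sq_abs (Fprim X τ m v)]
      _ = 81 * ∑ v ∈ latticeCube (corner s n) s, (idealDivisorCount (Ideal.span {coordElt v}) : ℝ) ^ 2 := by rw [mul_sum]
      _ ≤ 81 * (C₂ * s ^ 3 * Real.log s ^ e₂) := by
          gcongr; exact h45₂ _ _ hs2 (c1.trans hc3) (c2.trans hc3) (c3.trans hc3)
  -- monotonicity in the two sums, `R` and `N'`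
  have hR := sum_Ioc_sq_le hG1 hs0 (⌊3 * T⌋₊ + 1)
  have hR0 : 0 ≤ ∑ g ∈ Ioc ⌊Q₁ / Q₀⌋₊ (⌊3 * T⌋₊ + 1), (s / g + 1) ^ 2 := sum_nonneg fun g _ => by positivity
  have hN' : (((⌊s⌋₊ + 1 : ℕ) : ℝ)) ≤ s + 1 := by push_cast; linarith [Nat.floor_le hs0]
  have hN'0 : (0 : ℝ) ≤ ((⌊s⌋₊ + 1 : ℕ) : ℝ) := by positivity
  have hS30 : 0 ≤ ∑ v ∈ latticeCube (corner s n) s, (idealDivisorCount (Ideal.span {coordElt v}) : ℝ) ^ 3 :=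
    sum_nonneg fun v _ => by positivity
  have hrpow : ((∑ v ∈ latticeCube (corner s n) s, (idealDivisorCount (Ideal.span {coordElt v}) : ℝ) ^ 3) ^ (1 / 3 : ℝ)) ^ 2 ≤
      (C₃ * s ^ 3 * Real.log s ^ e₃) ^ (2 / 3 : ℝ) := by
    have e : ((∑ v ∈ latticeCube (corner s n) s, (idealDivisorCount (Ideal.span {coordElt v}) : ℝ) ^ 3) ^ (1 / 3 : ℝ)) ^ 2 =
        (∑ v ∈ latticeCube (corner s n) s, (idealDivisorCount (Ideal.span {coordElt v}) : ℝ) ^ 3) ^ (2 / 3 : ℝ) := by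
      rw [← Real.rpow_natCast, ← Real.rpow_mul hS30]; norm_num
    rw [e]
    exact Real.rpow_le_rpow hS30 hS3 (by norm_num)
  have hH0 : 0 ≤ (C₁ * V * Real.exp (-(c₁ * Real.sqrt (Real.log (hbL X τ))))) ^ 2 := sq_nonneg _
  have hlogQ : 0 ≤ Real.log Q₀ := Real.log_nonneg (by exact_mod_cast hQ₀)
  have hlogd : 0 ≤ Real.log (2 * d₀) := Real.log_nonneg (by linarith)
  have hC3r : 0 ≤ (C₃ * s ^ 3 * Real.log s ^ e₃) ^ (2 / 3 : ℝ) := Real.rpow_nonneg (mul_nonneg (by positivity) (pow_nonneg hlog _)) _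
  gcongr

/-! ### The bound for `S₄⁺` -/

open scoped Classical in
/-- **The bound for `|S₄⁺|`**: Class I cells (Möbius, characters, weights, large sieve, (3.14), tail) and
Class II cells (Lemma 11.1 and the count of Class II hypercubes). All constants explicit in terms of those
of Lemma 4.5 (`C₂, e₂, C₃, e₃`), Lemma 11.1 (`C₁₁, E, κ`) and (3.14) (`C₁, c₁`).
[cite: HeathBrownActa2001, Lemma 12.2] -/
theorem abs_S4plus_le (hX : 1 < X) (hη0 : 0 ≤ η) (hη1 : η ≤ 1) (hτ : 0 < τ) (hτ1 : τ ≤ 1) {nn : ℕ}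
    {m : Fin (nn + 1) → ℕ} (hm : CoreAdmissible τ m) {Q₁ C₁ c₁ : ℝ} (hHyp : Hyp314 X τ m Q₁ C₁ c₁ 3 1)
    (hT : 0 < T) (hTV : T ^ 3 = V) (hN : 1248 ≤ N) (hs2 : 2 ≤ T / N) (hsN : 3 * (N : ℝ) + 2 ≤ (T / N) ^ 2)
    (hsL : hbL X τ ^ 2 ≤ T / N) (hVX : X ≤ 270 * V)
    {C₂ C₃ C₁₁ κ : ℝ} {e₂ e₃ E : ℕ} (hC₂ : 0 < C₂) (hC₃ : 0 < C₃) (hC₁₁ : 0 < C₁₁)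
    (h45₂ : ∀ (a : ℝ × ℝ × ℝ) (S₀ : ℝ), 2 ≤ S₀ → |a.1| ≤ S₀ ^ 3 → |a.2.1| ≤ S₀ ^ 3 → |a.2.2| ≤ S₀ ^ 3 →
      ∑ v ∈ latticeCube a S₀, (idealDivisorCount (Ideal.span {coordElt v}) : ℝ) ^ 2 ≤ C₂ * S₀ ^ 3 * Real.log S₀ ^ e₂)
    (h45₃ : ∀ (a : ℝ × ℝ × ℝ) (S₀ : ℝ), 2 ≤ S₀ → |a.1| ≤ S₀ ^ 3 → |a.2.1| ≤ S₀ ^ 3 → |a.2.2| ≤ S₀ ^ 3 →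
      ∑ v ∈ latticeCube a S₀, (idealDivisorCount (Ideal.span {coordElt v}) : ℝ) ^ 3 ≤ C₃ * S₀ ^ 3 * Real.log S₀ ^ e₃)
    (h11 : ∀ (a₁ a₂ : ℝ × ℝ × ℝ) (S₀ : ℝ), 2 ≤ S₀ →
      |a₁.1| ≤ S₀ ^ 3 → |a₁.2.1| ≤ S₀ ^ 3 → |a₁.2.2| ≤ S₀ ^ 3 →
        ∀ D : ℕ, 1 ≤ D → (D : ℝ) ≤ κ * S₀ →
          ∑ b ∈ (latticeCube a₁ S₀).filter IsPrimitiveVec,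
              ∑ _x ∈ (latticeCube a₂ S₀).filter (fun x => DvdVec (D : ℤ) (cross3 b x)),
                (idealDivisorCount (Ideal.span {coordElt b}) : ℝ) ^ 2 ≤
            C₁₁ * S₀ ^ 6 / (D : ℝ) ^ 2 * Real.log S₀ ^ E)
    (hκs : 270 * V / X ≤ κ * (T / N))
    {Q₀ : ℕ} (hQ₀ : 1 ≤ Q₀) (hQ₀₁ : (Q₀ : ℝ) ≤ Q₁) {Δ₀ : ℝ} (hΔ1 : 1 ≤ Δ₀) (hΔD : Δ₀ ≤ 270 * V / X)
    {d₀ : ℝ} (hd₀ : 1 ≤ d₀) :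
    |S4plus X η τ m V T Δ₀| ≤
      (6 * (N : ℝ) + 3) ^ 6 *
        (4 * (1 + Real.log Q₀) / Δ₀ * (Q₀ : ℝ) ^ 3 *
          (2 * ((Q₀ : ℝ) ^ 4 * Q₁ ^ 2 * (C₁ * V * Real.exp (-(c₁ * Real.sqrt (Real.log (hbL X τ))))) ^ 2 +
            162 * (C₃ * (T / N) ^ 3 * Real.log (T / N) ^ e₃) ^ (2 / 3 : ℝ) *
              (2 * (T / N) ^ 2 / (Q₁ / Q₀) + 2 * (T / N) * (1 + Real.log ((⌊3 * T⌋₊ + 1 : ℕ) : ℝ)) + ((⌊3 * T⌋₊ + 1 : ℕ) : ℝ)) ^ 2)) +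
        414720 * (1 + Real.log (2 * d₀)) / Δ₀ *
          ((T / N + 1) ^ 3 / Q₀ + d₀ * (T / N + 1) ^ 2 + d₀ ^ 3) * (81 * (C₂ * (T / N) ^ 3 * Real.log (T / N) ^ e₂))) +
      81 * TL T d₀ +
      ((N : ℝ) * (Real.log (270 * V / X) - Real.log Δ₀) + 2) * (34000000000 * (6 * (N : ℝ) + 3) ^ 5) *
        (81 * (C₁₁ * (T / N) ^ 6 * Real.log (T / N) ^ E * (2 / (N * Δ₀) + 3 / Δ₀ ^ 2))) := by
  classical
  have hX0 : 0 < X := by linarith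
  have hN0 : 0 < N := by omega
  have hΔ0 : 0 < Δ₀ := by linarith
  have hd0 : 0 ≤ d₀ := by linarith
  rw [S4plus_eq_classI_add_classII hX0 hη1 hT hTV hN0 hΔ1]
  refine (abs_add_le _ _).trans ?_
  have hII := sum_classII_abs_S5_le hX hη0 hη1 hτ hτ1 hm hT hTV hN hC₁₁ h11 hs2 hsN hκs hΔ1 hΔD
  have hI := sum_abs_classISum_le (η := η) (Δ₀ := Δ₀) hX hτ hτ1 hm hT hTV hN0 hVX hd0
  refine add_le_add ((abs_sum_le_sum_abs _ _).trans (hI.trans (add_le_add ?_ le_rfl))) ((abs_sum_le_sum_abs _ _).trans hII)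
  -- the Class I main part: `#Nrange · ∑_{good} A_n ≤ (6N+3)⁶ · Abound`
  set GN := (Nrange N).filter (fun n => goodCube V T N n) with hGN
  set Ab : ℝ := 4 * (1 + Real.log Q₀) / Δ₀ * (Q₀ : ℝ) ^ 3 *
          (2 * ((Q₀ : ℝ) ^ 4 * Q₁ ^ 2 * (C₁ * V * Real.exp (-(c₁ * Real.sqrt (Real.log (hbL X τ))))) ^ 2 +
            162 * (C₃ * (T / N) ^ 3 * Real.log (T / N) ^ e₃) ^ (2 / 3 : ℝ) *
              (2 * (T / N) ^ 2 / (Q₁ / Q₀) + 2 * (T / N) * (1 + Real.log ((⌊3 * T⌋₊ + 1 : ℕ) : ℝ)) + ((⌊3 * T⌋₊ + 1 : ℕ) : ℝ)) ^ 2)) +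
        414720 * (1 + Real.log (2 * d₀)) / Δ₀ *
          ((T / N + 1) ^ 3 / Q₀ + d₀ * (T / N + 1) ^ 2 + d₀ ^ 3) * (81 * (C₂ * (T / N) ^ 3 * Real.log (T / N) ^ e₂)) with hAb
  have hAn : ∀ n ∈ GN, ∑ q ∈ Icc 1 ⌊d₀⌋₊, wt Δ₀ ⌊810 * V / X⌋₊ d₀ q * Ustar (Fprim X τ m) (LC (T / N) n) q ≤ Ab := by
    intro n hn
    rw [hGN, mem_filter] at hn
    exact sum_wt_Ustar_good_le hX hτ hτ1 hm hHyp hT hTV hN0 hs2 hsN hsL hC₃ h45₂ h45₃ hQ₀ hQ₀₁ hΔ0 hd₀ _ hn.1 hn.2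
  have hA0 : ∀ n, 0 ≤ ∑ q ∈ Icc 1 ⌊d₀⌋₊, wt Δ₀ ⌊810 * V / X⌋₊ d₀ q * Ustar (Fprim X τ m) (LC (T / N) n) q :=
    fun n => sum_nonneg fun q _ => mul_nonneg (wt_nonneg _ _ _ _) (Ustar_nonneg _ _ _)
  have hAb0 : 0 ≤ Ab := by
    have hlog : 0 ≤ Real.log (T / N) := Real.log_nonneg (by linarith)
    have hlogQ : 0 ≤ Real.log Q₀ := Real.log_nonneg (by exact_mod_cast hQ₀)
    have hlogd : 0 ≤ Real.log (2 * d₀) := Real.log_nonneg (by linarith)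
    have hlog3 : 0 ≤ Real.log ((⌊3 * T⌋₊ + 1 : ℕ) : ℝ) := by
      apply Real.log_nonneg
      have : (1 : ℝ) ≤ ((⌊3 * T⌋₊ + 1 : ℕ) : ℝ) := by
        have h0 : (0 : ℝ) ≤ (⌊3 * T⌋₊ : ℝ) := Nat.cast_nonneg _
        push_cast; linarith
      exact this
    have hs0 : 0 ≤ T / N := by linarith
    have hQR : (0:ℝ) < Q₀ := by exact_mod_cast hQ₀
    have hQQ : 0 < Q₁ / Q₀ := div_pos (lt_of_lt_of_le hQR hQ₀₁) hQR
    have h1 : 0 ≤ (C₃ * (T / N) ^ 3 * Real.log (T / N) ^ e₃) ^ (2 / 3 : ℝ) :=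
      Real.rpow_nonneg (mul_nonneg (by positivity) (pow_nonneg hlog _)) _
    have h2 : 0 ≤ Real.log (T / N) ^ e₂ := pow_nonneg hlog _
    have h3 : 0 ≤ (C₁ * V * Real.exp (-(c₁ * Real.sqrt (Real.log (hbL X τ))))) ^ 2 := sq_nonneg _
    rw [hAb]
    positivity
  calc (#(Nrange N) : ℝ) * ∑ n ∈ GN, ∑ q ∈ Icc 1 ⌊d₀⌋₊, wt Δ₀ ⌊810 * V / X⌋₊ d₀ q * Ustar (Fprim X τ m) (LC (T / N) n) q
      ≤ #(Nrange N) * ∑ _n ∈ GN, Ab := by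
        gcongr with n hn
        exact hAn n hn
    _ = #(Nrange N) * (#GN * Ab) := by rw [sum_const, nsmul_eq_mul]
    _ ≤ (6 * (N : ℝ) + 3) ^ 3 * ((6 * (N : ℝ) + 3) ^ 3 * Ab) := by
        have h1 := card_Nrange_le N
        have h2 : (#GN : ℝ) ≤ (6 * (N : ℝ) + 3) ^ 3 := le_trans (by exact_mod_cast card_le_card (filter_subset _ _)) h1
        gcongr
    _ = (6 * (N : ℝ) + 3) ^ 6 * Ab := by ring

end Literature.NumberTheory.Sieve.CubicSieve

end
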